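import Summits.QuantumFields.YangMills.Theorems.BalabanLadderUVSeamRecCeilingsDLRPeelingLinearBudgetSlices
import HarnessLib

/-!
# Crux `UVSeamRec` (stmt-QuantumFields-20043), lane B: the (UCR) ⇒ doubled-moments engine with a LINEAR budget — the summability clause of the
# large-field half becomes the PLAIN sum `Σ_k w_k` of the one-box weights (no `16K`-th root)

Helper file (`--supports stmt-QuantumFields-20043`) of the width-lever seat `ym-20043-ceilings-p2` (lane B, gen 8); assembles
`…CeilingsDLRPeelingExpWeights` (window family ⇒ `⟨exp(Σ t_γ 1_γ)⟩ ≤ exp((1/K)Σ(e^{Kt_γ} − 1)w)`, `K = 256(2m+4)⁴`), `…CeilingsDLRPeelingLevelSlices`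
(level `0` in the same currency from the PROVED plaquette law; sign classes; depth arithmetic) and `…CeilingsDLRPeelingLinearBudgetSlices` (the
geometric-exponent Hölder assembly `integral_exp_two_mul_sum_le_of_levels`; the slice moments).

THE POINT.  g3's level assembly (`…ResponseCarriersLevelwise`) runs Hölder across the levels with exponents `p_k ∝ 1/Λ_k` (`Λ_k` the cap of the
per-polymer coefficient), so every level is driven at the top level's strength and the per-level laws must be PRODUCT LAWS — whence thinning and the
roots `δ^{1/16}` (sign classes) and `w^{1/(16K)}` (g6/g7's (UCR) chain, p573746/p580265).  Here the exponents are GEOMETRIC in the depth `j` below the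
top shell level `K` (`2b^K ≤ R`): `2^{j+1}` at level `K − j`.  Since `Λ_{K−j} ≤ b^{−4j}`, the exponential weight seen by the level's peeling is
`≤ 64K(2/b⁴)^j ≤ 1` once `j ≥ m+4` (`deep_weight_le_one`), and there `e^x − 1 ≤ (e−1)x` makes the level's Hölder constant `2(e−1)·1536·w_k·#T` —
LINEAR in the (UCR) weight; such levels fit in the torus (`deep_fits`); the `≤ m+4` top levels are bounded TRIVIALLY by their coefficient mass
(`3072·#T` each; they include g7's non-fitting levels); level `0`, when deep, runs on the proved period-free plaquette law in the same currency.
* `torusE_exp_two_mul_sum_influence_le_of_uniformConditionalRarity_linear` — fundamental `SU(N)`, odd torus `2L+1`, `β ≥ 1`, REDUCED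
  `2R+4`-separated family, ANY odd block size, ANY collar `m ≥ 3`, weights `w_k ≥ 0` with (UCR_k) at every level `k ≥ 1`:
  `⟨exp(2Σ_{i∈T} influence 𝔟 ε kmax R (x i)∘lift)⟩_{2L+1,β} ≤ exp((3072(m+4) + 2(e−1)·1536·(δ₀(β) + Σ_{1≤k≤kmax} w_k))·#T)`,
  `δ₀(β) = exp(−βNε₀/#Orient + (K₀ + D₁ log β)/#Orient)` the proved level-`0` activity.  Compare g7's `…_anyCollar` (p580265):
  `exp(2e²·1536·(δ₀ + Σ_k w_k^{1/(16·256(2m+4)⁴)} + m)·#T)`.  The sequel `…LinearBudgetGlue` carries this to (RM) and to the v8-shaped glue with the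
  summability clause `Σ_{1≤k≤kmax β R} w β k ≤ D` — Bałaban's `Σ_j exp(−p₀(g_j))` currency; `w_k ≤ k^{−2}` would already do.
HONEST FRAMING.  Folklore probability (DLR peeling, Hölder); (UCR_k) is the OPEN one-box large-field input (Bałaban's R-operation currency with
Dirichlet data; classical consistency `ε(β,k) ≳ π⁴/(2(2m+1)⁴)`, `m` free and now entering the budget ADDITIVELY); nothing of E0′; not a gap, not Clay.
References: folklore; T. Bałaban, Commun. Math. Phys. 122 (1989) 355–392 (intended supplier of (UCR_k)).
-/

set_option autoImplicit false

noncomputable section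

open MeasureTheory Filter Topology Finset
open Literature.Probability.LatticeModels
open Literature.MathematicalPhysics.QuantumFieldTheory (GaugeConfig wilsonMeasure LatticeRep isProbabilityMeasure_wilsonMeasure
  measurable_torusLift)
open Literature.MathematicalPhysics.QuantumLattice (LGConfig torusLift IsCylinder ymSpecification isProbabilityMeasure_ymSpecification
  integrable_of_abs_le fundamentalLatticeRep)

namespace Summit.QuantumFields.YangMills.Cruxes.UVSeamRec.DLRPeeling

open Summit.QuantumFields.YangMills.Cruxes.OSLegsFromFemtoAndGap.DlrCollarTransfer
open Summit.QuantumFields.YangMills.Cruxes.UVSeamRec.PolymerData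
open Summit.QuantumFields.YangMills.Cruxes.UVSeamRec.TemperedResponse
open Summit.QuantumFields.YangMills.Theorems.OddTorusChessboard (Orient)

section Linear

variable {N : ℕ} [NeZero N]

/-- **DOUBLED JOINT EXPONENTIAL MOMENTS OF THE INFLUENCE FUNCTIONALS FROM (UCR) WITH A LINEAR BUDGET.**  Fundamental Wilson state of `SU(N)` on the
odd torus `2L+1`, `β ≥ 1`; a REDUCED cube family (`|x i c| ≤ L`), pairwise cyclically `2R+4`-separated, `1 ≤ R`, `4R+8 ≤ L`; ANY odd block size `𝔟`,
ANY collar `m ≥ 3`, thresholds `ε`, cutoff `kmax`; weights `w k ≥ 0` with the ONE-BOX bound (UCR_k) at every level `k ≥ 1`: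
`∀ y μ<ν η, kerE^η_{(b^k(y−m),(2m+1)b^k)}(1_{largeFieldEvent 𝔟 (ε k) (k,y,μ,ν)}) ≤ w k`.  THEN, with the constants `K₀, D₁` of the proved level-`0` law,
`⟨exp(2 Σ_{i∈T} influence 𝔟 ε kmax R (x i)∘lift)⟩_{2L+1,β} ≤ exp((3072·(m+4) + 2(e−1)·1536·(δ₀ + Σ_{1≤k≤kmax} w k))·#T)`,
`δ₀ = exp(−βNε₀/#Orient + (K₀ + D₁ log β)/#Orient)`.  The budget is LINEAR in the weights: no root, `m` enters additively.
Proof: slice by level (`sum_influence_eq_sum_slices`); Hölder across the levels `K − j` (`2b^K ≤ R`) with exponents `2^{j+1}`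
(`integral_exp_two_mul_sum_le_of_levels`); deep levels (`j ≥ m+4`) by `slice_exp_moment_deep` over the peeling of exponential weights
(`torusE_exp_sum_indicator_le_of_uniformKernelBound`, level `0` over `torusE_exp_sum_indicator_levelZero_le`) with `deep_weight_le_one`/`deep_fits`;
top levels by `slice_exp_moment_trivial`.  No RP, no divisibility, every block size, every collar. [folklore] -/
theorem torusE_exp_two_mul_sum_influence_le_of_uniformConditionalRarity_linear :
    ∃ K₀ : ℝ, ∃ D₁ : ℕ, ∀ (𝔟 : BlockSize) (m : ℕ), 3 ≤ m → ∀ (ε : ℕ → ℝ) (kmax R L : ℕ) (β : ℝ), 1 ≤ β →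
      ∀ {n : ℕ} (x : Fin n → (Fin 4 → ℤ)), 1 ≤ R → 4 * R + 8 ≤ L → (∀ i c, |x i c| ≤ (L : ℤ)) →
      (∀ i j : Fin n, i ≠ j → ∃ k : Fin 4,
        (2 * (R : ℤ) + 4) ≤ |((((x i k - x j k : ℤ) : ZMod (2 * L + 1))).valMinAbs : ℤ)|) →
      ∀ (w : ℕ → ℝ), (∀ k, 0 ≤ w k) →
      (∀ k : ℕ, 1 ≤ k → ∀ (y : Fin 4 → ℤ) (μ ν : Fin 4) (h : μ < ν) (η : LGConfig 4 (Matrix.specialUnitaryGroup (Fin N) ℂ)),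
        kerE (Matrix.specialUnitaryGroup (Fin N) ℂ) (fundamentalLatticeRep N) β (fun i => (𝔟.b : ℤ) ^ k * (y i - m)) ((2 * m + 1) * 𝔟.b ^ k) η
          ((largeFieldEvent (N := N) 𝔟 (ε k) ⟨k, y, μ, ν, h⟩).indicator fun _ => (1 : ℝ)) ≤ w k) →
      ∀ T : Finset (Fin n),
        torusE (Matrix.specialUnitaryGroup (Fin N) ℂ) (fundamentalLatticeRep N) β L
            (fun U => Real.exp (((2 : ℕ) : ℝ) * ∑ i ∈ T, influence (N := N) 𝔟 ε kmax R (x i) U)) ≤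
          Real.exp ((3072 * ((m : ℝ) + 4) + 2 * (Real.exp 1 - 1) * 1536 *
            (Real.exp (-(β * ((N : ℝ) * ε 0)) / Fintype.card (Orient 4) + (K₀ + D₁ * Real.log β) / Fintype.card (Orient 4)) +
              ∑ k ∈ (Finset.range (kmax + 1)).filter (fun k => 1 ≤ k), w k)) * T.card) := by
  classical
  obtain ⟨K₀, D₁, hPL0⟩ := torusE_exp_sum_indicator_levelZero_le (N := N)
  refine ⟨K₀, D₁, ?_⟩
  intro 𝔟 m hm ε kmax R L β hβ n x hR hRL hred hsep w hw0 hUCR T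
  haveI := isProbabilityMeasure_wilsonMeasure (d := 4) (L := 2 * L + 1) (fundamentalLatticeRep N).ρ
    (fundamentalLatticeRep N).continuous β
  have hL : 1 ≤ L := by omega
  set μT := wilsonMeasure (d := 4) (L := 2 * L + 1) (fundamentalLatticeRep N).ρ β with hμT
  set δ₀ : ℝ := Real.exp (-(β * ((N : ℝ) * ε 0)) / Fintype.card (Orient 4) + (K₀ + D₁ * Real.log β) / Fintype.card (Orient 4))
    with hδ₀def
  have hδ₀0 : 0 ≤ δ₀ := (Real.exp_pos _).le
  set cD : ℝ := 2 * (Real.exp 1 - 1) * 1536 with hcDdef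
  have he1 : 1 ≤ Real.exp 1 - 1 := by have := Real.add_one_le_exp (1 : ℝ); linarith
  have hcD0 : 0 ≤ cD := by rw [hcDdef]; nlinarith
  set Wsum : ℝ := ∑ k ∈ (Finset.range (kmax + 1)).filter (fun k => 1 ≤ k), w k with hWsum
  have hW0 : 0 ≤ Wsum := Finset.sum_nonneg fun k _ => hw0 k
  have hT0 : (0 : ℝ) ≤ T.card := Nat.cast_nonneg _
  have hB0 : 0 ≤ (3072 * ((m : ℝ) + 4) + cD * (δ₀ + Wsum)) * T.card := by positivity
  -- the slices `J_k`
  let S : ℕ → Finset Polymer := fun k => (familyShell 𝔟 kmax R x).filter (fun γ => γ.k = k)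
  have hSk : ∀ k, ∀ γ ∈ S k, γ.k = k := fun k γ hγ => (Finset.mem_filter.1 hγ).2
  have hSsub : ∀ k, S k ⊆ familyShell 𝔟 kmax R x := fun k => Finset.filter_subset _ _
  let a : Polymer → ℝ := fun γ => ∑ i ∈ T, familyCoeff 𝔟 kmax R x i γ
  have ha0 : ∀ γ, 0 ≤ a γ := fun γ => Finset.sum_nonneg fun i _ => familyCoeff_nonneg 𝔟 kmax R x i γ
  have hacap : ∀ γ, a γ ≤ 16 * ((𝔟.b : ℝ) ^ γ.k / ((R : ℝ) + 2 + 2 * (𝔟.b : ℝ) ^ γ.k)) ^ 4 := fun γ =>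
    (Finset.sum_le_univ_sum_of_nonneg fun i => familyCoeff_nonneg 𝔟 kmax R x i γ).trans
      (sum_familyCoeff_le_levelCap' 𝔟 kmax R hRL x hsep γ)
  let J : ℕ → GaugeConfig 4 (2 * L + 1) (Matrix.specialUnitaryGroup (Fin N) ℂ) → ℝ := fun k U =>
    ∑ γ ∈ S k, a γ * (largeFieldEvent (N := N) 𝔟 (ε γ.k) γ).indicator (fun _ => (1 : ℝ)) (torusLift (2 * L + 1) U)
  have hχ01 : ∀ γ (U : LGConfig 4 (Matrix.specialUnitaryGroup (Fin N) ℂ)),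
      0 ≤ (largeFieldEvent (N := N) 𝔟 (ε γ.k) γ).indicator (fun _ => (1 : ℝ)) U ∧
        (largeFieldEvent (N := N) 𝔟 (ε γ.k) γ).indicator (fun _ => (1 : ℝ)) U ≤ 1 := fun γ U =>
    ⟨Set.indicator_nonneg (fun _ _ => zero_le_one) _, Set.indicator_apply_le' (fun _ => le_rfl) (fun _ => zero_le_one)⟩
  have hJm : ∀ k, Measurable (J k) := fun k => Finset.measurable_sum _ fun γ _ =>
    ((measurable_const.indicator (measurableSet_largeFieldEvent (N := N) 𝔟 _ γ)).comp (measurable_torusLift _)).const_mul _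
  have hJ0 : ∀ k U, 0 ≤ J k U := fun k U => Finset.sum_nonneg fun γ _ => mul_nonneg (ha0 γ) (hχ01 γ _).1
  have hJle : ∀ k U, J k U ≤ 1536 * T.card := by
    intro k U
    have hmass : ∑ γ ∈ S k, a γ ≤ 1536 * T.card := by
      calc ∑ γ ∈ S k, a γ = ∑ i ∈ T, ∑ γ ∈ S k, familyCoeff 𝔟 kmax R x i γ := Finset.sum_comm
        _ ≤ ∑ _i ∈ T, (1536 : ℝ) := Finset.sum_le_sum fun i _ => sum_familyCoeff_slice_le 𝔟 kmax R x i k (S k) (hSk k)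
        _ = 1536 * T.card := by rw [Finset.sum_const, nsmul_eq_mul, mul_comm]
    exact (Finset.sum_le_sum fun γ _ => by simpa using mul_le_mul_of_nonneg_left (hχ01 γ _).2 (ha0 γ)).trans hmass
  have hJb : ∀ k U, |J k U| ≤ 1536 * T.card := fun k U => by rw [abs_of_nonneg (hJ0 k U)]; exact hJle k U
  -- the left-hand side in sliced form
  have hlhs : torusE (Matrix.specialUnitaryGroup (Fin N) ℂ) (fundamentalLatticeRep N) β L
      (fun U => Real.exp (((2 : ℕ) : ℝ) * ∑ i ∈ T, influence (N := N) 𝔟 ε kmax R (x i) U)) =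
      ∫ U, Real.exp (2 * ∑ k ∈ Finset.range (kmax + 1), J k U) ∂μT := by
    unfold torusE
    refine integral_congr_ae (ae_of_all _ fun U => ?_)
    simp only [J, S, a, Nat.cast_ofNat, sum_influence_eq_sum_slices (N := N) 𝔟 ε kmax R x T]
  rw [hlhs]
  -- Case `R = 1`: no shell polymers at all
  by_cases hR2 : 2 * 𝔟.b ^ 0 ≤ R
  swap
  · have hempty : ∀ k, S k = ∅ := by
      intro k
      refine Finset.eq_empty_of_forall_notMem fun γ hγ => ?_
      obtain ⟨i, _, hi⟩ := Finset.mem_biUnion.1 (hSsub k hγ)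
      have hsh := (mem_shell_iff 𝔟 kmax R (x i) γ).1 hi
      have h2 : 2 * 𝔟.b ^ γ.k ≤ R := by have := hsh.2.1.trans hsh.2.2; omega
      have h1 : 𝔟.b ^ 0 ≤ 𝔟.b ^ γ.k := Nat.pow_le_pow_right 𝔟.pos (Nat.zero_le _)
      exact hR2 (by omega)
    have hJ : ∀ k U, J k U = 0 := fun k U => by simp only [J, hempty, Finset.sum_empty]
    simp only [hJ, Finset.sum_const_zero, mul_zero, Real.exp_zero, integral_const, smul_eq_mul, mul_one, probReal_univ]
    exact Real.one_le_exp hB0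
  -- the top shell level `K`
  set K : ℕ := Nat.findGreatest (fun k => 2 * 𝔟.b ^ k ≤ R) kmax with hKdef
  have hK2 : 2 * 𝔟.b ^ K ≤ R := Nat.findGreatest_spec (P := fun k => 2 * 𝔟.b ^ k ≤ R) (Nat.zero_le kmax) hR2
  have hKle : K ≤ kmax := Nat.findGreatest_le kmax
  have hzero : ∀ k, K < k → k ≤ kmax → ∀ U, J k U = 0 := by
    intro k hk hk' U
    have hS : S k = ∅ := by
      refine Finset.eq_empty_of_forall_notMem fun γ hγ => ?_
      obtain ⟨i, _, hi⟩ := Finset.mem_biUnion.1 (hSsub k hγ)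
      have hsh := (mem_shell_iff 𝔟 kmax R (x i) γ).1 hi
      have h2 : 2 * 𝔟.b ^ γ.k ≤ R := by have := hsh.2.1.trans hsh.2.2; omega
      rw [hSk k γ hγ] at h2
      exact Nat.findGreatest_is_greatest (P := fun k => 2 * 𝔟.b ^ k ≤ R) hk hk' h2
    simp only [J, hS, Finset.sum_empty]
  -- constants of the levels
  set K' : ℝ := 256 * (2 * (m : ℝ) + 4) ^ 4 with hK'def
  have hK'1 : 1 ≤ K' := by
    rw [hK'def]
    have : (1 : ℝ) ≤ (2 * (m : ℝ) + 4) ^ 4 := one_le_pow₀ (by linarith [(Nat.cast_nonneg m : (0 : ℝ) ≤ m)])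
    nlinarith
  have hK'0 : 0 < K' := by linarith
  let θ : ℕ → ℝ := fun k => if k = 0 then δ₀ else w k
  have hθ0 : ∀ k, 0 ≤ θ k := fun k => by by_cases hk : k = 0 <;> simp [θ, hk, hδ₀0, hw0]
  let C : ℕ → ℝ := fun j => if j ≤ m + 3 then 3072 * T.card else cD * θ (K - j) * T.card
  -- the window-family laws in the exponential currency: level `k ≥ 1` (peeling) and level `0` (plaquette law)
  have hWF : ∀ k : ℕ, 1 ≤ k → (2 * m + 1) * 𝔟.b ^ k + 3 ≤ 2 * L + 1 →
      ∀ (o : Fin 4 → ℤ) (A : Finset Polymer), A ⊆ familyShell 𝔟 kmax R x → (∀ γ ∈ A, γ.k = k) →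
      (∀ γ ∈ A, ∀ c, o c ≤ anchor 𝔟 γ c ∧ anchor 𝔟 γ c + (𝔟.b : ℤ) ^ k ≤ o c + (2 * L + 1)) →
      ∀ t : Polymer → ℝ, (∀ γ ∈ A, 0 ≤ t γ) →
      torusE (Matrix.specialUnitaryGroup (Fin N) ℂ) (fundamentalLatticeRep N) β L (fun U => Real.exp (∑ γ ∈ A,
        t γ * (largeFieldEvent (N := N) 𝔟 (ε k) γ).indicator (fun _ => (1 : ℝ)) U)) ≤
        Real.exp (1 / K' * ∑ γ ∈ A, (Real.exp (K' * t γ) - 1) * w k) := by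
    intro k hk hfit o A _ hA hwin t ht
    have h := torusE_exp_sum_indicator_le_of_uniformKernelBound (fundamentalLatticeRep N) β 𝔟 m hm (ε k) k L hfit (w k) (hw0 k)
      (hUCR k hk) o A hA hwin t ht
    simpa only [hK'def] using h
  have hWF0 : ∀ (o : Fin 4 → ℤ) (A : Finset Polymer), A ⊆ familyShell 𝔟 kmax R x → (∀ γ ∈ A, γ.k = 0) →
      (∀ γ ∈ A, ∀ c, o c ≤ anchor 𝔟 γ c ∧ anchor 𝔟 γ c + (𝔟.b : ℤ) ^ (0 : ℕ) ≤ o c + (2 * L + 1)) →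
      ∀ t : Polymer → ℝ, (∀ γ ∈ A, 0 ≤ t γ) →
      torusE (Matrix.specialUnitaryGroup (Fin N) ℂ) (fundamentalLatticeRep N) β L (fun U => Real.exp (∑ γ ∈ A,
        t γ * (largeFieldEvent (N := N) 𝔟 (ε 0) γ).indicator (fun _ => (1 : ℝ)) U)) ≤
        Real.exp (1 / (1 : ℝ) * ∑ γ ∈ A, (Real.exp ((1 : ℝ) * t γ) - 1) * δ₀) := by
    intro o A _ hA hwin t ht
    have h := hPL0 𝔟 (ε 0) L hL β hβ o A hA hwin t ht
    simpa only [one_mul, div_one, hδ₀def] using h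
  -- per-level Hölder bounds
  have hmom : ∀ j, j ≤ K → ∫ U, Real.exp ((2 : ℝ) ^ (j + 1) * (2 * J (K - j) U)) ∂μT ≤ Real.exp ((2 : ℝ) ^ (j + 1) * C j) := by
    intro j hjK
    set k := K - j with hkdef
    have hkj : k + j = K := by omega
    have hc : (0 : ℝ) ≤ (2 : ℝ) ^ (j + 1) * 2 := by positivity
    have hassoc : ∀ U, (2 : ℝ) ^ (j + 1) * (2 * J k U) = (2 : ℝ) ^ (j + 1) * 2 * J k U := fun U => by ring
    simp only [hassoc]
    by_cases htop : j ≤ m + 3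
    · -- a top level: trivial bound by the coefficient mass
      have hCj : C j = 3072 * T.card := if_pos htop
      rw [hCj, show (2 : ℝ) ^ (j + 1) * (3072 * (T.card : ℝ)) = (2 : ℝ) ^ (j + 1) * 2 * (1536 * T.card) by ring]
      exact slice_exp_moment_trivial (N := N) β 𝔟 ε kmax R L k x T hc
    -- a deep level: peeling of exponential weights, linearised
    have hdeep : m + 4 ≤ j := by omega
    have hCj : C j = cD * θ k * T.card := by simp only [C, if_neg htop, hkdef]
    rw [hCj]
    have hsmall : ∀ γ ∈ S k, 16 * K' * ((2 : ℝ) ^ (j + 1) * 2 * a γ) ≤ 1 := by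
      intro γ hγ
      have h1 := hacap γ
      rw [hSk k γ hγ] at h1
      simpa only [hK'def] using deep_weight_le_one 𝔟 hm hK2 hkj hdeep h1
    by_cases hk0 : k = 0
    · -- level `0`: the proved plaquette law
      have hθk : θ k = δ₀ := by simp only [θ, hk0, if_true]
      have hsmall0 : ∀ γ ∈ (familyShell 𝔟 kmax R x).filter (fun γ => γ.k = 0),
          16 * (1 : ℝ) * ((2 : ℝ) ^ (j + 1) * 2 * ∑ i ∈ T, familyCoeff 𝔟 kmax R x i γ) ≤ 1 := by
        intro γ hγ
        rw [← hk0] at hγ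
        have h1 := hsmall γ hγ
        have h0 : 0 ≤ (2 : ℝ) ^ (j + 1) * 2 * a γ := mul_nonneg hc (ha0 γ)
        calc 16 * (1 : ℝ) * ((2 : ℝ) ^ (j + 1) * 2 * a γ) ≤ 16 * K' * ((2 : ℝ) ^ (j + 1) * 2 * a γ) := by
              refine mul_le_mul_of_nonneg_right ?_ h0; linarith
          _ ≤ 1 := h1
      have h := slice_exp_moment_deep (N := N) β 𝔟 (ε 0) kmax R L 0 hRL x hred T one_pos hδ₀0 hWF0 hc hsmall0
      rw [hθk, show (2 : ℝ) ^ (j + 1) * (cD * δ₀ * (T.card : ℝ)) = (2 : ℝ) ^ (j + 1) * 2 * ((Real.exp 1 - 1) * 1536 * δ₀ * T.card) by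
        rw [hcDdef]; ring]
      refine (le_of_eq ?_).trans h
      refine integral_congr_ae (ae_of_all _ fun U => congrArg Real.exp (congrArg _ ?_))
      rw [hk0]
      exact Finset.sum_congr rfl fun γ hγ => by rw [(Finset.mem_filter.1 hγ).2]
    · -- level `k ≥ 1`: peeling
      have hk1 : 1 ≤ k := Nat.one_le_iff_ne_zero.2 hk0
      have hθk : θ k = w k := by simp only [θ, hk0, if_false]
      have hfit : (2 * m + 1) * 𝔟.b ^ k + 3 ≤ 2 * L + 1 := deep_fits 𝔟 hK2 hRL hkj hdeep
      have h := slice_exp_moment_deep (N := N) β 𝔟 (ε k) kmax R L k hRL x hred T hK'0 (hw0 k) (hWF k hk1 hfit) hc hsmall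
      rw [hθk, show (2 : ℝ) ^ (j + 1) * (cD * w k * (T.card : ℝ)) = (2 : ℝ) ^ (j + 1) * 2 * ((Real.exp 1 - 1) * 1536 * w k * T.card) by
        rw [hcDdef]; ring]
      refine (le_of_eq ?_).trans h
      refine integral_congr_ae (ae_of_all _ fun U => congrArg Real.exp (congrArg _ ?_))
      exact Finset.sum_congr rfl fun γ hγ => by rw [(Finset.mem_filter.1 hγ).2]
  -- Hölder across the levels
  have key := integral_exp_two_mul_sum_le_of_levels μT J hJm hJb kmax K hKle hzero C hmom
  refine key.trans (Real.exp_le_exp.2 ?_)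
  -- the budget: `Σ_{j ≤ K} C j ≤ (3072(m+4) + cD(δ₀ + Σ_{1≤k≤kmax} w k))·#T`
  have hCle : ∀ j ∈ Finset.range (K + 1), C j ≤ 3072 * T.card * (if j ≤ m + 3 then 1 else 0) + cD * T.card * θ (K - j) := by
    intro j _
    by_cases htop : j ≤ m + 3
    · have h1 : C j = 3072 * T.card := if_pos htop
      rw [h1, if_pos htop, mul_one]
      have := mul_nonneg (mul_nonneg hcD0 hT0) (hθ0 (K - j))
      linarith
    · have h1 : C j = cD * θ (K - j) * T.card := if_neg htop
      rw [h1, if_neg htop, mul_zero, zero_add]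
      exact le_of_eq (by ring)
  refine (Finset.sum_le_sum hCle).trans ?_
  rw [Finset.sum_add_distrib, ← Finset.mul_sum, ← Finset.mul_sum]
  have hcount : ∑ j ∈ Finset.range (K + 1), (if j ≤ m + 3 then (1 : ℝ) else 0) ≤ (m : ℝ) + 4 := by
    rw [Finset.sum_boole]
    have : ((Finset.range (K + 1)).filter (fun j => j ≤ m + 3)).card ≤ m + 4 := by
      calc ((Finset.range (K + 1)).filter (fun j => j ≤ m + 3)).card ≤ (Finset.range (m + 4)).card :=
            Finset.card_le_card fun j hj => Finset.mem_range.2 (by have := (Finset.mem_filter.1 hj).2; omega)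
        _ = m + 4 := Finset.card_range _
    exact_mod_cast this
  have hθsum : ∑ j ∈ Finset.range (K + 1), θ (K - j) ≤ δ₀ + Wsum := by
    rw [← Finset.sum_range_reflect (fun j => θ (K - j)) (K + 1)]
    simp only [add_tsub_cancel_right]
    have h2 : ∀ j ∈ Finset.range (K + 1), θ (K - (K - j)) = θ j := fun j hj => by
      rw [Nat.sub_sub_self (Nat.lt_succ_iff.1 (Finset.mem_range.1 hj))]
    have h0 : θ 0 = δ₀ := if_pos rfl
    have h1 : ∀ i, θ (i + 1) = w (i + 1) := fun i => if_neg (Nat.succ_ne_zero i)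
    rw [Finset.sum_congr rfl h2, Finset.sum_range_succ']
    show ((∑ k ∈ Finset.range K, θ (k + 1)) + θ 0) ≤ δ₀ + Wsum
    rw [h0, Finset.sum_congr rfl fun i _ => h1 i, add_comm]
    refine add_le_add le_rfl ?_
    -- `Σ_{i < K} w (i+1) = Σ_{k ∈ Ico 1 (K+1)} w k ≤ Σ_{1 ≤ k ≤ kmax} w k`
    have h3 : ∑ i ∈ Finset.range K, w (i + 1) = ∑ k ∈ Finset.Ico 1 (K + 1), w k := by
      rw [Finset.sum_Ico_eq_sum_range]
      simp only [add_tsub_cancel_right]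
      exact Finset.sum_congr rfl fun i _ => by rw [add_comm]
    rw [h3, hWsum]
    refine Finset.sum_le_sum_of_subset_of_nonneg (fun k hk => ?_) fun k _ _ => hw0 k
    simp only [Finset.mem_Ico, Finset.mem_filter, Finset.mem_range] at hk ⊢
    exact ⟨by omega, hk.1⟩
  have h3072 : (0 : ℝ) ≤ 3072 * T.card := by positivity
  have hcDT : 0 ≤ cD * T.card := by positivity
  calc 3072 * (T.card : ℝ) * ∑ j ∈ Finset.range (K + 1), (if j ≤ m + 3 then (1 : ℝ) else 0) +
        cD * T.card * ∑ j ∈ Finset.range (K + 1), θ (K - j)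
      ≤ 3072 * (T.card : ℝ) * ((m : ℝ) + 4) + cD * T.card * (δ₀ + Wsum) :=
        add_le_add (mul_le_mul_of_nonneg_left hcount h3072) (mul_le_mul_of_nonneg_left hθsum hcDT)
    _ = (3072 * ((m : ℝ) + 4) + cD * (δ₀ + Wsum)) * T.card := by ring

end Linear

end Summit.QuantumFields.YangMills.Cruxes.UVSeamRec.DLRPeeling

end
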